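import Summits.AtomisticToContinuum.Crystallization.Theorems.ChessboardParticlePlanesPeriodicWindowsStubWideGapSyndetic

/-!
# Crux `PeriodicWindows` (stmt-AtomisticToContinuum-3240), line `dense-laminar-hull` — stub
# `hc_wideGapSyndetic` (uniform recurrence makes gaps `≥ τ + η` syndetic; elementary)

This is the landed GS1 `stub_wideGapSyndetic` with the gap threshold `1` replaced by an arbitrary
real `τ` (the landed proof never used the value of the threshold).

For the general aligned layered set `Z = B '' {i • v₁(a) + j • v₂(a) + δ m + z m • e₃}` (`B` a
linear isometry of `ℝ³` preserving the third coordinate, horizontal offsets `δ`, strictly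
increasing heights `z` with consecutive gaps `≥ 3/4`) which is rooted-uniformly recurrent (for all
`R, ε > 0` some `G` such that within `G` of every point of `Z` there is `g ∈ Z` with `Z - g`
two-way `ε`-matched with `Z` on the ball `B(0, R)`), ONE gap `z (m₀+1) - z m₀ ≥ τ + 2η` (`η > 0`)
forces gaps `≥ τ + η` to occur with bounded gaps in the layer INDEX.

* `hcw_layerPoint_apply_two` — a layer point `i • v₁ + j • v₂ + d + t • e₃` (`d` horizontal) has
  height `t`;
* `hcw_norm_triangularVec₁_eq`, `hcw_norm_triangularVec₂_eq`, `hcw_norm_layerNormal_one` —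
  `‖v₁‖ = ‖v₂‖ = a`, `‖e₃‖ = 1`;
* `hcw_exists_lattice_near` — every horizontal vector is within `2a` of `ℤ v₁ + ℤ v₂` (write
  `h = α v₁ + β v₂` and round the coefficients down);
* `hcw_exists_layerPoint_near` — hence every layer `k` of `Z` has a point within
  `2a + |z k - c 2|` of any `c ∈ ℝ³`;
* `hcw_gap_accumulate` — `(3/4)(k - m) ≤ z k - z m` for `m ≤ k`;
* `hc_wideGapSyndetic` — for a layer index `m` take `w ∈ Z` on layer `m` and the recurrence
  witness `g ∈ Z` (on layer `m₁`, `|z m₁ - z m| ≤ G`); a layer at a height strictly inside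
  `(z m₁ + z m₀ + ε, z m₁ + z (m₀+1) - ε)` would contain a point `r` with `r - g ∈ (Z - g) ∩ B(0, R)`
  whose height is `ε`-far from all heights of `Z`, against the matching; so the last layer `k⋆`
  with `z k⋆ ≤ z m₁ + z m₀ + ε` is followed by a gap `≥ z (m₀+1) - z m₀ - 2ε ≥ τ + η`, and
  `|k⋆ - m| ≤ L` with `L` independent of `m` by the `3/4`-gaps; shifting `m` by `L` makes the index
  offset land in `[0, 2L]`.

All elementary. [folklore]
-/

noncomputable section

namespace Summit.AtomisticToContinuum.Crystallization.Theorems.PeriodicWindowsDenseLaminarHull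

open Literature.MathematicalPhysics.StatisticalMechanics Filter Metric
open scoped BigOperators

/-! ## Coordinates and norms of the layer vectors -/

/-- The third coordinate of a layer point `i • v₁ + j • v₂ + d + t • e₃` with `d` horizontal is
`t`. [folklore] -/
private theorem hcw_layerPoint_apply_two (a i j t : ℝ) {d : EuclideanSpace ℝ (Fin 3)}
    (hd : d 2 = 0) :
    (i • triangularVec₁ a + j • triangularVec₂ a + d + t • layerNormal 1) 2 = t := by
  simp [triangularVec₁, triangularVec₂, layerNormal, hd]

/-- `‖v₁(a)‖ = a` for `a ≥ 0`. [folklore] -/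
private theorem hcw_norm_triangularVec₁_eq {a : ℝ} (ha : 0 ≤ a) : ‖triangularVec₁ a‖ = a := by
  rw [EuclideanSpace.norm_eq]
  simp [triangularVec₁, Fin.sum_univ_three, Real.sqrt_sq_eq_abs, abs_of_nonneg ha]

/-- `‖v₂(a)‖ = a` for `a ≥ 0` (`(a/2)² + (a√3/2)² = a²`). [folklore] -/
private theorem hcw_norm_triangularVec₂_eq {a : ℝ} (ha : 0 ≤ a) : ‖triangularVec₂ a‖ = a := by
  have h3 : Real.sqrt 3 ^ 2 = 3 := Real.sq_sqrt (by norm_num)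
  have e0 : (triangularVec₂ a) 0 = a / 2 := by simp [triangularVec₂]
  have e1 : (triangularVec₂ a) 1 = a * Real.sqrt 3 / 2 := by simp [triangularVec₂]
  have e2 : (triangularVec₂ a) 2 = 0 := by simp [triangularVec₂]
  have h : ‖triangularVec₂ a‖ ^ 2 = a ^ 2 := by
    rw [EuclideanSpace.real_norm_sq_eq, Fin.sum_univ_three, e0, e1, e2]
    linear_combination (a ^ 2 / 4) * h3
  exact (pow_left_inj₀ (norm_nonneg _) ha two_ne_zero).1 h

/-- `‖e₃‖ = 1` for `e₃ = layerNormal 1 = (0, 0, 1)`. [folklore] -/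
private theorem hcw_norm_layerNormal_one : ‖(layerNormal 1 : EuclideanSpace ℝ (Fin 3))‖ = 1 := by
  rw [EuclideanSpace.norm_eq]
  simp [layerNormal, Fin.sum_univ_three]

/-! ## Covering: every layer passes within `2a` of every vertical line -/

/-- **Crude covering radius of the triangular lattice.** Every horizontal vector `h` (`h 2 = 0`)
is within `2a` of a point of `ℤ v₁(a) + ℤ v₂(a)` (`a > 0`): `h = α v₁ + β v₂` with
`β = 2 h₁ / (a√3)`, `α = h₀ / a - β / 2`, and rounding the coefficients down leaves
`{α} v₁ + {β} v₂`, of norm `≤ ‖v₁‖ + ‖v₂‖ = 2a`. [folklore] -/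
private theorem hcw_exists_lattice_near {a : ℝ} (ha : 0 < a) (h : EuclideanSpace ℝ (Fin 3))
    (hh : h 2 = 0) :
    ∃ i j : ℤ, ‖h - ((i : ℝ) • triangularVec₁ a + (j : ℝ) • triangularVec₂ a)‖ ≤ 2 * a := by
  have ha' : a ≠ 0 := ha.ne'
  have hs3 : Real.sqrt 3 ≠ 0 := (Real.sqrt_pos.2 (by norm_num : (0 : ℝ) < 3)).ne'
  obtain ⟨β, hβ⟩ : ∃ β : ℝ, β = 2 * h 1 / (a * Real.sqrt 3) := ⟨_, rfl⟩
  obtain ⟨α, hα⟩ : ∃ α : ℝ, α = h 0 / a - β / 2 := ⟨_, rfl⟩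
  have hdec : h = α • triangularVec₁ a + β • triangularVec₂ a := by
    ext l
    fin_cases l
    · simp [triangularVec₁, triangularVec₂, hα]
      field_simp
      ring
    · simp [triangularVec₁, triangularVec₂, hβ]
      field_simp
    · simp [triangularVec₁, triangularVec₂, hh]
  refine ⟨⌊α⌋, ⌊β⌋, ?_⟩
  have hrem : h - (((⌊α⌋ : ℤ) : ℝ) • triangularVec₁ a + ((⌊β⌋ : ℤ) : ℝ) • triangularVec₂ a) =
      Int.fract α • triangularVec₁ a + Int.fract β • triangularVec₂ a := by
    rw [hdec]
    unfold Int.fract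
    module
  have hfa : |Int.fract α| ≤ 1 :=
    abs_le.2 ⟨by linarith [Int.fract_nonneg α], (Int.fract_lt_one α).le⟩
  have hfb : |Int.fract β| ≤ 1 :=
    abs_le.2 ⟨by linarith [Int.fract_nonneg β], (Int.fract_lt_one β).le⟩
  rw [hrem]
  calc ‖Int.fract α • triangularVec₁ a + Int.fract β • triangularVec₂ a‖
      ≤ ‖Int.fract α • triangularVec₁ a‖ + ‖Int.fract β • triangularVec₂ a‖ := norm_add_le _ _
    _ = |Int.fract α| * a + |Int.fract β| * a := by
        rw [norm_smul, norm_smul, Real.norm_eq_abs, Real.norm_eq_abs,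
          hcw_norm_triangularVec₁_eq ha.le, hcw_norm_triangularVec₂_eq ha.le]
    _ ≤ 1 * a + 1 * a := by gcongr
    _ = 2 * a := by ring

/-- **Every layer passes within `2a` of every point, horizontally.** For the layered set with frame
`B` (a linear isometry preserving heights), horizontal offsets `δ` and heights `z`, layer `k`
contains a point within `2a + |z k - c 2|` of any `c ∈ ℝ³`: decompose `B⁻¹ c = h + δ k + (c 2) e₃`
with `h` horizontal and approximate `h` in `ℤ v₁ + ℤ v₂` by `hcw_exists_lattice_near`.
[folklore] -/
private theorem hcw_exists_layerPoint_near {a : ℝ} (ha : 0 < a)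
    (B : EuclideanSpace ℝ (Fin 3) ≃ₗᵢ[ℝ] EuclideanSpace ℝ (Fin 3))
    (δ : ℤ → EuclideanSpace ℝ (Fin 3)) (z : ℤ → ℝ)
    (hB : ∀ p : EuclideanSpace ℝ (Fin 3), (B p) 2 = p 2) (hδ : ∀ m : ℤ, (δ m) 2 = 0) (k : ℤ)
    (c : EuclideanSpace ℝ (Fin 3)) :
    ∃ i j : ℤ, dist (B (((i : ℝ) • triangularVec₁ a) + ((j : ℝ) • triangularVec₂ a) + δ k +
      (z k • layerNormal 1))) c ≤ 2 * a + |z k - c 2| := by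
  have hc2 : (B.symm c) 2 = c 2 := by
    have h1 := hB (B.symm c)
    rw [LinearIsometryEquiv.apply_symm_apply] at h1
    exact h1.symm
  have hn2 : (layerNormal 1 : EuclideanSpace ℝ (Fin 3)) 2 = 1 := by simp [layerNormal]
  obtain ⟨h, hh⟩ : ∃ h : EuclideanSpace ℝ (Fin 3), h = B.symm c - δ k - (c 2) • layerNormal 1 :=
    ⟨_, rfl⟩
  have hh2 : h 2 = 0 := by
    rw [hh, PiLp.sub_apply, PiLp.sub_apply, PiLp.smul_apply, hc2, hδ k, hn2, smul_eq_mul, mul_one,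
      sub_zero, sub_self]
  obtain ⟨i, j, hij⟩ := hcw_exists_lattice_near ha h hh2
  refine ⟨i, j, ?_⟩
  have hP : ((i : ℝ) • triangularVec₁ a) + ((j : ℝ) • triangularVec₂ a) + δ k +
      (z k • layerNormal 1) - B.symm c =
      -(h - ((i : ℝ) • triangularVec₁ a + (j : ℝ) • triangularVec₂ a)) +
        (z k - c 2) • layerNormal 1 := by
    rw [hh]
    module
  calc dist (B (((i : ℝ) • triangularVec₁ a) + ((j : ℝ) • triangularVec₂ a) + δ k +
        (z k • layerNormal 1))) c
      = dist (B (((i : ℝ) • triangularVec₁ a) + ((j : ℝ) • triangularVec₂ a) + δ k +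
          (z k • layerNormal 1))) (B (B.symm c)) := by rw [LinearIsometryEquiv.apply_symm_apply]
    _ = ‖((i : ℝ) • triangularVec₁ a) + ((j : ℝ) • triangularVec₂ a) + δ k +
          (z k • layerNormal 1) - B.symm c‖ := by
        rw [LinearIsometryEquiv.dist_map, dist_eq_norm]
    _ = ‖-(h - ((i : ℝ) • triangularVec₁ a + (j : ℝ) • triangularVec₂ a)) +
          (z k - c 2) • layerNormal 1‖ := by rw [hP]
    _ ≤ ‖-(h - ((i : ℝ) • triangularVec₁ a + (j : ℝ) • triangularVec₂ a))‖ +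
          ‖(z k - c 2) • (layerNormal 1 : EuclideanSpace ℝ (Fin 3))‖ := norm_add_le _ _
    _ = ‖h - ((i : ℝ) • triangularVec₁ a + (j : ℝ) • triangularVec₂ a)‖ + |z k - c 2| := by
        rw [norm_neg, norm_smul, Real.norm_eq_abs, hcw_norm_layerNormal_one, mul_one]
    _ ≤ 2 * a + |z k - c 2| := by gcongr

/-! ## Heights with gaps `≥ 3/4` -/

/-- Gaps `≥ 3/4` accumulate: `(3/4) n ≤ z (m + n) - z m`. [folklore] -/
private theorem hcw_gap_accumulate {z : ℤ → ℝ} (hgap : ∀ m : ℤ, (3 : ℝ) / 4 ≤ z (m + 1) - z m)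
    (m : ℤ) (n : ℕ) : (3 : ℝ) / 4 * n ≤ z (m + n) - z m := by
  induction n with
  | zero => simp
  | succ n ih =>
    have h1 := hgap (m + n)
    rw [add_assoc] at h1
    push_cast
    linarith

/-- Gaps `≥ 3/4` accumulate: `(3/4)(k - m) ≤ z k - z m` for `m ≤ k`. [folklore] -/
private theorem hcw_gap_accumulate' {z : ℤ → ℝ} (hgap : ∀ m : ℤ, (3 : ℝ) / 4 ≤ z (m + 1) - z m)
    {m k : ℤ} (hmk : m ≤ k) : (3 : ℝ) / 4 * ((k : ℝ) - m) ≤ z k - z m := by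
  obtain ⟨n, rfl⟩ := Int.le.dest hmk
  have h1 := hcw_gap_accumulate hgap m n
  push_cast
  linarith

/-! ## The stub -/

/-- **HC helper (numerics-free, elementary): uniform recurrence makes gaps `≥ τ + η` syndetic.**
Let `Z = B '' {i • v₁(a) + j • v₂(a) + δ m + z m • e₃}` be a general layered set (`B` a linear
isometry preserving the third coordinate, horizontal offsets `δ`, strictly increasing heights `z`
with gaps `≥ 3/4`) which is uniformly recurrent in the rooted sense (for every `R, ε` some `G`
such that within `G` of every point of `Z` there is `g ∈ Z` with `Z - g` two-way `ε`-matched with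
`Z` on `B(0, R)`). If ONE gap is `≥ τ + 2η` (`η > 0`, `τ` an arbitrary real threshold), then gaps
`≥ τ + η` occur with bounded index gaps: `∃ G, ∀ m, ∃ g ∈ [0, G], z (m+g+1) - z (m+g) ≥ τ + η`.
Route (verbatim the one of GS1 `stub_wideGapSyndetic`, which is the case `τ = 1`): with
`ε = min(η/2, 1/2)`, `R = 2a + |z m₀| + |z (m₀+1)|`, take `w ∈ Z` on layer `m` and the recurrence
witness `g ∈ Z` within `G(R, ε)` of it, on layer `m₁` (`|z m₁ - z m| ≤ G`, coordinates being
`1`-Lipschitz); a layer of `Z` at a height strictly inside `(z m₁ + z m₀ + ε, z m₁ + z (m₀+1) - ε)`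
has a point `r` within horizontal distance `2a` of `g` (`hcw_exists_layerPoint_near`), and
`r - g ∈ (Z - g) ∩ B(0, R)` is `ε`-far in height from every layer of `Z` (strict monotonicity of
`z`) — against the matching; hence the largest `k` with `z k ≤ z m₁ + z m₀ + ε`
(`Int.exists_greatest_of_bdd`, the heights being unbounded in both directions by
`hcw_gap_accumulate`) has `z (k+1) - z k ≥ (z (m₀+1) - z m₀) - 2ε ≥ τ + η`, and
`|k - m| ≤ L = ⌈(4/3)(G + |z m₀| + |z (m₀+1)| + 1)⌉₊ + 1` by the `3/4`-gaps; applying this at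
`m + L` puts the offset in `[0, 2L]`. [folklore] -/
theorem hc_wideGapSyndetic : ∀ a : ℝ, 0 < a →
    ∀ (B : EuclideanSpace ℝ (Fin 3) ≃ₗᵢ[ℝ] EuclideanSpace ℝ (Fin 3)) (δ : ℤ → EuclideanSpace ℝ (Fin 3)) (z : ℤ → ℝ),
    (∀ p : EuclideanSpace ℝ (Fin 3), (B p) 2 = p 2) → (∀ m : ℤ, (δ m) 2 = 0) → StrictMono z →
    (∀ m : ℤ, (3 : ℝ) / 4 ≤ z (m + 1) - z m) →
    ∀ Z : Set (EuclideanSpace ℝ (Fin 3)), Z = (fun p => B p) '' {p | ∃ m i j : ℤ, p = ((i : ℝ) • triangularVec₁ a) +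
      ((j : ℝ) • triangularVec₂ a) + δ m + (z m • layerNormal 1)} →
    (∀ R ε : ℝ, 0 < ε → ∃ G : ℝ, ∀ w ∈ Z, ∃ g ∈ Z, dist g w ≤ G ∧
      BallMatch ε R 0 ((fun p => p - g) '' Z) Z) →
    ∀ τ η : ℝ, 0 < η → ∀ m₀ : ℤ, τ + 2 * η ≤ z (m₀ + 1) - z m₀ →
    ∃ G : ℕ, ∀ m : ℤ, ∃ g : ℤ, 0 ≤ g ∧ g ≤ G ∧ τ + η ≤ z (m + g + 1) - z (m + g) := by
  intro a ha B δ z hB hδ hz hgap Z hZ hrec τ η hη m₀ hm₀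
  -- (F1) layer points: membership and heights
  have hmem : ∀ m i j : ℤ, B (((i : ℝ) • triangularVec₁ a) + ((j : ℝ) • triangularVec₂ a) + δ m +
      (z m • layerNormal 1)) ∈ Z := fun m i j => by
    rw [hZ]
    exact ⟨_, ⟨m, i, j, rfl⟩, rfl⟩
  have hpt2 : ∀ m i j : ℤ, (B (((i : ℝ) • triangularVec₁ a) + ((j : ℝ) • triangularVec₂ a) +
      δ m + (z m • layerNormal 1))) 2 = z m := fun m i j => by
    rw [hB]
    exact hcw_layerPoint_apply_two a i j (z m) (hδ m)
  have hZ2 : ∀ p ∈ Z, ∃ m : ℤ, p 2 = z m := by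
    intro p hp
    rw [hZ] at hp
    obtain ⟨q, ⟨m, i, j, rfl⟩, rfl⟩ := hp
    exact ⟨m, hpt2 m i j⟩
  -- coordinates are `1`-Lipschitz
  have hlip : ∀ p q : EuclideanSpace ℝ (Fin 3), |p 2 - q 2| ≤ dist p q := fun p q => by
    rw [← Real.dist_eq]
    exact PiLp.dist_apply_le p q 2
  -- (F2) covering: layer `k` has a point within `2a + |z k - c 2|` of any `c`
  have hcov : ∀ (k : ℤ) (c : EuclideanSpace ℝ (Fin 3)),
      ∃ r ∈ Z, r 2 = z k ∧ dist r c ≤ 2 * a + |z k - c 2| := by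
    intro k c
    obtain ⟨i, j, hij⟩ := hcw_exists_layerPoint_near ha B δ z hB hδ k c
    exact ⟨_, hmem k i j, hpt2 k i j, hij⟩
  -- growth of the heights
  have hgrow : ∀ m k : ℤ, m ≤ k → (3 : ℝ) / 4 * ((k : ℝ) - m) ≤ z k - z m :=
    fun m k hmk => hcw_gap_accumulate' hgap hmk
  -- the constants
  obtain ⟨ε, hε_def⟩ : ∃ ε : ℝ, ε = min (η / 2) (1 / 2) := ⟨_, rfl⟩
  have hε : 0 < ε := by rw [hε_def]; exact lt_min (by linarith) (by norm_num)
  have hεη : ε ≤ η / 2 := hε_def ▸ min_le_left _ _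
  have hε1 : ε ≤ 1 / 2 := hε_def ▸ min_le_right _ _
  obtain ⟨G, hG⟩ := hrec (2 * a + |z m₀| + |z (m₀ + 1)|) ε hε
  obtain ⟨X, hX⟩ : ∃ X : ℝ, X = G + |z m₀| + |z (m₀ + 1)| + 1 := ⟨_, rfl⟩
  obtain ⟨L, hL_def⟩ : ∃ L : ℕ, L = ⌈(4 : ℝ) / 3 * X⌉₊ + 1 := ⟨_, rfl⟩
  have hL : (4 : ℝ) / 3 * X + 1 ≤ (L : ℝ) := by
    rw [hL_def]
    push_cast
    linarith [Nat.le_ceil ((4 : ℝ) / 3 * X)]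
  have h0 := abs_nonneg (z m₀)
  have h0' := abs_nonneg (z (m₀ + 1))
  have h0l := neg_abs_le (z m₀)
  have h0u := le_abs_self (z m₀)
  have h1l := neg_abs_le (z (m₀ + 1))
  have h1u := le_abs_self (z (m₀ + 1))
  -- the core claim: a wide gap within index distance `L` of every `m`
  have hcore : ∀ m : ℤ, ∃ k : ℤ, m - L ≤ k ∧ k ≤ m + L ∧ τ + η ≤ z (k + 1) - z k := by
    intro m
    -- (F3) the recurrence witness near layer `m`
    obtain ⟨w, hw, hw2⟩ : ∃ w ∈ Z, w 2 = z m := ⟨_, hmem m 0 0, hpt2 m 0 0⟩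
    obtain ⟨g, hg, hgw, hmatch⟩ := hG w hw
    obtain ⟨m₁, hgm₁⟩ := hZ2 g hg
    have hm₁m : |z m₁ - z m| ≤ G := by
      rw [← hgm₁, ← hw2]
      exact (hlip g w).trans hgw
    obtain ⟨hGlb, hGub⟩ := abs_le.1 hm₁m
    obtain ⟨T, hT⟩ : ∃ T : ℝ, T = z m₁ + z m₀ + ε := ⟨_, rfl⟩
    -- (F4) no layer strictly inside the shifted window
    have hF4 : ∀ k : ℤ, T < z k → z m₁ + z (m₀ + 1) - ε ≤ z k := by
      intro k hk
      rw [hT] at hk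
      by_contra hlt
      push Not at hlt
      obtain ⟨r, hr, hr2, hrg⟩ := hcov k g
      have hq : r - g ∈ (fun p => p - g) '' Z := ⟨r, hr, rfl⟩
      have hq0 : dist (r - g) 0 ≤ 2 * a + |z m₀| + |z (m₀ + 1)| := by
        rw [dist_zero_right, ← dist_eq_norm]
        refine hrg.trans ?_
        rw [hgm₁]
        have : |z k - z m₁| ≤ |z m₀| + |z (m₀ + 1)| := by
          rw [abs_le]
          constructor <;> linarith
        linarith
      obtain ⟨s, hs, hqs⟩ := hmatch.2 (r - g) hq hq0
      obtain ⟨k', hk'⟩ := hZ2 s hs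
      have h1 := (hlip (r - g) s).trans hqs
      rw [PiLp.sub_apply, hr2, hgm₁, hk', abs_le] at h1
      have hlo : z m₀ < z k' := by linarith [h1.1, h1.2]
      have hhi : z k' < z (m₀ + 1) := by linarith [h1.1, h1.2]
      have := hz.lt_iff_lt.1 hlo
      have := hz.lt_iff_lt.1 hhi
      omega
    -- (F5) the last layer below the threshold `T`
    obtain ⟨n, hn⟩ := exists_nat_ge ((4 : ℝ) / 3 * (|z m₀| + 1))
    have hn' : |z m₀| + 1 ≤ (3 : ℝ) / 4 * n := by linarith
    have hlow : z (m₁ - n) ≤ T := by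
      have h1 := hgrow (m₁ - n) m₁ (by omega)
      push_cast at h1
      rw [hT]
      linarith
    have hhigh : T < z (m₁ + n) := by
      have h1 := hgrow m₁ (m₁ + n) (by omega)
      push_cast at h1
      rw [hT]
      linarith
    obtain ⟨ks, hks, hksmax⟩ := Int.exists_greatest_of_bdd (P := fun k : ℤ => z k ≤ T)
      ⟨m₁ + n, fun k hk => (hz.lt_iff_lt.1 (hk.trans_lt hhigh)).le⟩ ⟨m₁ - n, hlow⟩
    have hks1 : T < z (ks + 1) := by
      by_contra hle
      have := hksmax (ks + 1) (not_lt.1 hle)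
      omega
    have hks2 : z m₁ + z (m₀ + 1) - ε ≤ z (ks + 1) := hF4 (ks + 1) hks1
    have hksT : z ks ≤ T := hks
    rw [hT] at hksT
    have hwide : τ + η ≤ z (ks + 1) - z ks := by linarith
    -- (F6) index bounds
    refine ⟨ks, ?_, ?_, hwide⟩
    · by_contra hlt
      push Not at hlt
      have h1 := hgrow (ks + 1) m (by omega)
      push_cast at h1
      have h2 : (L : ℝ) ≤ (m : ℝ) - (ks + 1) := by
        have : (L : ℤ) ≤ m - (ks + 1) := by omega
        exact_mod_cast this
      linarith
    · by_contra hlt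
      push Not at hlt
      have h1 := hgrow m ks (by omega)
      have h2 : (L : ℝ) ≤ (ks : ℝ) - m := by
        have : (L : ℤ) ≤ ks - m := by omega
        exact_mod_cast this
      linarith
  -- conclusion: apply the core claim at `m + L`
  refine ⟨2 * L, fun m => ?_⟩
  obtain ⟨k, hk1, hk2, hk⟩ := hcore (m + L)
  refine ⟨k - m, by omega, by push_cast; omega, ?_⟩
  have e : m + (k - m) = k := by omega
  rw [e]
  exact hk

end Summit.AtomisticToContinuum.Crystallization.Theorems.PeriodicWindowsDenseLaminarHull

end
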